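import Literature.AlgebraicGeometry.Resolution.OrderGenericAlongPrime
import Literature.AlgebraicGeometry.Resolution.OrderGenerizationCoheightOne
import Literature.AlgebraicGeometry.Resolution.QuasiExcellentSchemes
import Literature.AlgebraicGeometry.Resolution.ProjectiveSpaceRegular
import Literature.AlgebraicGeometry.Resolution.MarkedIdeals
import Mathlib.RingTheory.Localization.Ideal
import HarnessLib

/-!
# The order of an ideal sheaf is generically constant along a curve (excellent regular schemes)

Topic: `Literature/AlgebraicGeometry/Resolution`. Let `X` be an integral, locally Noetherian,
regular and excellent scheme, `J` an ideal sheaf and `η ∈ X` a point with `ord_η(J) = m`.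
**Theorem** (`exists_opens_forall_idealOrder_le`): there is an open neighbourhood `U` of `η` such
that `ord_x(J) ≤ m` for every specialization `x` of `η` in `U`. With `ord_x(J) ≥ ord_η(J)`
(`OrderSemicontinuityPointwise.lean`) this says that `ord_x(J) = m` on a dense open subset of the
closure of `η` — the constructibility half of "`Σ := {x ∈ X | m(x) = μ}` … is a closed subset of
`X` of dimension zero or one" in the proof of Cossart–Piltant 2008, Prop. 4.2. Excellence enters
through condition J-2 for an affine coordinate ring `A = Γ(X, U₀)`: the regular locus of `A/𝔭`
(`𝔭` the prime of `η`) is open, so `A_𝔮/𝔭A_𝔮` is regular for the primes `𝔮 ⊇ 𝔭` off some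
`g₀ ∉ 𝔭`, which is the hypothesis of the ring-level statement
`exists_not_mem_forall_mul_not_mem_pow` (`OrderGenericAlongPrime.lean`); the theorem is also
stated with only this J-2 hypothesis (`exists_opens_forall_idealOrder_le_of_isJ2`), the form
needed on the blown-up schemes of [CoP1] Prop. 4.2, which are J-2 but not known to be
excellent without Stacks 07PV.

## References

* V. Cossart, O. Piltant, J. Algebra 320 (2008), proof of Prop. 4.2. [cite: CossartPiltant2008, Prop. 4.2 (proof)]
* H. Matsumura, *Commutative Ring Theory*, §32 p. 260 (J-2). [cite: Matsumura1987, §32 p. 260]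
-/

noncomputable section

open CategoryTheory AlgebraicGeometry TopologicalSpace Topology IsLocalRing

namespace Literature.AlgebraicGeometry.Resolution

universe u

/-! ## Ring-level glue -/

section Ring

/-- **`A_𝔮/IA_𝔮` is regular as soon as `(A/I)_{𝔮/I}` is** (localisation of a quotient is the
quotient of the localisation). [folklore] -/
theorem isRegularLocalRing_quotient_map_of_localization_quotient {A : Type u} [CommRing A]
    (I : Ideal A) (𝔮 : Ideal A) [𝔮.IsPrime] (P : Ideal (A ⧸ I)) [P.IsPrime]
    (hP : P.comap (Ideal.Quotient.mk I) = 𝔮) (h : IsRegularLocalRing (Localization.AtPrime P)) :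
    IsRegularLocalRing (Localization.AtPrime 𝔮 ⧸ I.map (algebraMap A (Localization.AtPrime 𝔮))) := by
  have hmem : ∀ c : A, Ideal.Quotient.mk I c ∈ P ↔ c ∈ 𝔮 := fun c => by
    rw [← hP, Ideal.mem_comap]
  have hM : Algebra.algebraMapSubmonoid (A ⧸ I) 𝔮.primeCompl = P.primeCompl := by
    ext b
    constructor
    · rintro ⟨c, hc, rfl⟩
      exact fun h => hc ((hmem c).mp h)
    · intro hb
      obtain ⟨c, rfl⟩ := Ideal.Quotient.mk_surjective b
      exact ⟨c, fun h => hb ((hmem c).mpr h), rfl⟩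
  haveI : IsLocalization.AtPrime
      (Localization.AtPrime 𝔮 ⧸ I.map (algebraMap A (Localization.AtPrime 𝔮))) P := by
    have := (inferInstance : IsLocalization (Algebra.algebraMapSubmonoid (A ⧸ I) 𝔮.primeCompl)
      (Localization.AtPrime 𝔮 ⧸ I.map (algebraMap A (Localization.AtPrime 𝔮))))
    rwa [hM] at this
  exact IsRegularLocalRing.of_ringEquiv (IsLocalization.algEquiv P.primeCompl
    (Localization.AtPrime 𝔮 ⧸ I.map (algebraMap A (Localization.AtPrime 𝔮)))
    (Localization.AtPrime P)).toRingEquiv.symm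

/-- The localisation of a domain at `(0)` is a field, hence a regular local ring. [folklore] -/
theorem isRegularLocalRing_localization_bot {B : Type u} [CommRing B] [IsDomain B] :
    IsRegularLocalRing (Localization.AtPrime (⊥ : Ideal B)) := by
  haveI : IsLocalization (nonZeroDivisors B) (Localization.AtPrime (⊥ : Ideal B)) := by
    rw [← Ideal.primeCompl_bot]
    infer_instance
  letI : Field (Localization.AtPrime (⊥ : Ideal B)) := IsFractionRing.toField B
  infer_instance

/-- **J-2 along a prime**: in a J-2 ring `A`, for a prime `𝔭` there is `g₀ ∉ 𝔭` such that
`A_𝔮/𝔭A_𝔮` is a regular local ring for all primes `𝔮 ⊇ 𝔭` with `g₀ ∉ 𝔮` (the regular locus of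
the domain `A/𝔭` is open and contains its generic point). [cite: Matsumura1987, §32 p. 260] -/
theorem exists_not_mem_forall_isRegularLocalRing_quotient {A : Type u} [CommRing A]
    (hA : IsJ2Ring A) (𝔭 : Ideal A) [𝔭.IsPrime] :
    ∃ g₀ ∉ 𝔭, ∀ (𝔮 : Ideal A) [𝔮.IsPrime], 𝔭 ≤ 𝔮 → g₀ ∉ 𝔮 →
      IsRegularLocalRing (Localization.AtPrime 𝔮 ⧸ 𝔭.map (algebraMap A (Localization.AtPrime 𝔮))) := by
  haveI : Algebra.FiniteType A (A ⧸ 𝔭) := inferInstance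
  have hopen : IsOpen (regularLocus (A ⧸ 𝔭)) := hA.2 (A ⧸ 𝔭) inferInstance
  have hgen : (⟨⊥, Ideal.isPrime_bot⟩ : PrimeSpectrum (A ⧸ 𝔭)) ∈ regularLocus (A ⧸ 𝔭) :=
    isRegularLocalRing_localization_bot
  obtain ⟨_, ⟨gbar, rfl⟩, hmem, hsub⟩ :=
    PrimeSpectrum.isTopologicalBasis_basic_opens.exists_subset_of_mem_open hgen hopen
  obtain ⟨g₀, rfl⟩ := Ideal.Quotient.mk_surjective gbar
  refine ⟨g₀, fun h => ?_, fun 𝔮 _ h𝔭𝔮 hg𝔮 => ?_⟩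
  · rw [SetLike.mem_coe, PrimeSpectrum.mem_basicOpen] at hmem
    exact hmem (by rw [Ideal.Quotient.eq_zero_iff_mem.mpr h]; exact Submodule.zero_mem _)
  · -- the prime `𝔮/𝔭` of `A/𝔭` lies in the regular locus
    have hker : RingHom.ker (Ideal.Quotient.mk 𝔭) ≤ 𝔮 := by rw [Ideal.mk_ker]; exact h𝔭𝔮
    haveI hQ : (𝔮.map (Ideal.Quotient.mk 𝔭)).IsPrime :=
      Ideal.map_isPrime_of_surjective Ideal.Quotient.mk_surjective hker
    have hcomap : (𝔮.map (Ideal.Quotient.mk 𝔭)).comap (Ideal.Quotient.mk 𝔭) = 𝔮 := by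
      rw [Ideal.comap_map_of_surjective _ Ideal.Quotient.mk_surjective, ← RingHom.ker_eq_comap_bot,
        sup_eq_left.mpr hker]
    have hQmem : (⟨𝔮.map (Ideal.Quotient.mk 𝔭), hQ⟩ : PrimeSpectrum (A ⧸ 𝔭)) ∈
        regularLocus (A ⧸ 𝔭) := by
      apply hsub
      rw [SetLike.mem_coe, PrimeSpectrum.mem_basicOpen]
      intro h
      have : g₀ ∈ (𝔮.map (Ideal.Quotient.mk 𝔭)).comap (Ideal.Quotient.mk 𝔭) := h
      rw [hcomap] at this
      exact hg𝔮 this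
    exact isRegularLocalRing_quotient_map_of_localization_quotient 𝔭 𝔮
      (𝔮.map (Ideal.Quotient.mk 𝔭)) hcomap hQmem

end Ring

/-! ## The theorem -/

/-- **The order of an ideal sheaf is generically `≤ ord_η` along the closure of `η`**, on an
integral locally Noetherian regular scheme whose affine coordinate rings are J-2 (only the J-2
property of excellence is used): if `ord_η(J) = m` then there is an open `U ∋ η` with
`ord_x(J) ≤ m` for all `x ∈ U` with `η ⤳ x`. [cite: CossartPiltant2008, Prop. 4.2 (proof)] -/
theorem exists_opens_forall_idealOrder_le_of_isJ2 {X : Scheme.{u}} [IsIntegral X]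
    [IsLocallyNoetherian X] (hX : Scheme.IsRegular X)
    (hJ2 : ∀ U : X.affineOpens, IsJ2Ring Γ(X, U)) (J : X.IdealSheafData) (η : X) {m : ℕ}
    (hm : idealOrder J η = m) :
    ∃ U : X.Opens, η ∈ U ∧ ∀ x ∈ U, η ⤳ x → idealOrder J x ≤ m := by
  -- an affine open neighbourhood `U = Spec A` of `η`
  obtain ⟨U, hU, hηU, -⟩ :=
    exists_isAffineOpen_mem_and_subset (X := X) (x := η) (U := ⊤) (Opens.mem_top η)
  haveI : Nonempty U := ⟨⟨η, hηU⟩⟩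
  let A := Γ(X, U)
  haveI : IsNoetherianRing A := IsLocallyNoetherian.component_noetherian ⟨U, hU⟩
  haveI : IsRegularRing A := hX.isRegularRing_of_isAffineOpen hU
  replace hJ2 : IsJ2Ring A := hJ2 ⟨U, hU⟩
  -- primes and stalks of points of `U`
  let 𝔓 : ∀ x : X, x ∈ U → Ideal A := fun x hx => (hU.primeIdealOf ⟨x, hx⟩).asIdeal
  have h𝔓p : ∀ x (hx : x ∈ U), (𝔓 x hx).IsPrime := fun x hx => (hU.primeIdealOf ⟨x, hx⟩).2
  set 𝔭 := 𝔓 η hηU with h𝔭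
  haveI : 𝔭.IsPrime := h𝔓p η hηU
  set 𝔍 : Ideal A := J.ideal ⟨U, hU⟩ with h𝔍
  -- the order at a point of `U` read in `A`
  have hord : ∀ (x : X) (hx : x ∈ U) (n : ℕ),
      (n : ℕ∞) ≤ idealOrder J x ↔ ∀ f ∈ 𝔍, ∃ s ∉ 𝔓 x hx, s * f ∈ 𝔓 x hx ^ n := by
    intro x hx n
    letI algx : Algebra A (X.presheaf.stalk x) := TopCat.Presheaf.algebra_section_stalk X.presheaf ⟨x, hx⟩
    haveI := h𝔓p x hx
    haveI : IsLocalization.AtPrime (X.presheaf.stalk x) (𝔓 x hx) := hU.isLocalization_stalk ⟨x, hx⟩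
    have hst : stalkIdeal J x = 𝔍.map (algebraMap A (X.presheaf.stalk x)) :=
      stalkIdeal_eq_map_germ J ⟨U, hU⟩ hx
    rw [le_idealOrder_iff, hst, Ideal.map_le_iff_le_comap]
    constructor
    · intro h f hf
      exact exists_mul_mem_pow_of_algebraMap_mem_maximalIdeal_pow (𝔓 x hx) (X.presheaf.stalk x) (h hf)
    · intro h f hf
      obtain ⟨s, hs, hsf⟩ := h f hf
      exact algebraMap_mem_maximalIdeal_pow_of_mul_mem_pow (𝔓 x hx) (X.presheaf.stalk x) hs hsf
  -- an element `f ∈ J(U)` of order exactly `m` along `𝔭`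
  have hm1 : ((m : ℕ) : ℕ∞) ≤ idealOrder J η := hm.ge
  have hm2 : ¬ ((m + 1 : ℕ) : ℕ∞) ≤ idealOrder J η := by
    rw [hm]
    exact_mod_cast Nat.not_succ_le_self m
  rw [hord η hηU] at hm1 hm2
  push Not at hm2
  obtain ⟨f, hf𝔍, hfm1⟩ := hm2
  have hfm : ∃ s ∉ 𝔭, s * f ∈ 𝔭 ^ m := hm1 f hf𝔍
  -- J-2 and the ring-level generic bound
  obtain ⟨g, hg𝔭, hg⟩ := exists_not_mem_forall_mul_not_mem_pow 𝔭 hfm hfm1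
    (exists_not_mem_forall_isRegularLocalRing_quotient hJ2 𝔭)
  -- the open set `D(g) ⊆ U`
  refine ⟨X.basicOpen g, ?_, fun x hx hηx => ?_⟩
  · rw [Scheme.mem_basicOpen (hx := hηU)]
    letI algη : Algebra A (X.presheaf.stalk η) := TopCat.Presheaf.algebra_section_stalk X.presheaf ⟨η, hηU⟩
    haveI : IsLocalization.AtPrime (X.presheaf.stalk η) 𝔭 := hU.isLocalization_stalk ⟨η, hηU⟩
    exact (IsLocalization.AtPrime.isUnit_to_map_iff (X.presheaf.stalk η) 𝔭 g).mpr hg𝔭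
  · have hxU : x ∈ U := X.basicOpen_le g hx
    -- `g ∉ 𝔮 := 𝔓 x`
    letI algx : Algebra A (X.presheaf.stalk x) := TopCat.Presheaf.algebra_section_stalk X.presheaf ⟨x, hxU⟩
    haveI := h𝔓p x hxU
    haveI : IsLocalization.AtPrime (X.presheaf.stalk x) (𝔓 x hxU) := hU.isLocalization_stalk ⟨x, hxU⟩
    have hgx : g ∉ 𝔓 x hxU := by
      rw [Scheme.mem_basicOpen (hx := hxU)] at hx
      exact (IsLocalization.AtPrime.isUnit_to_map_iff (X.presheaf.stalk x) (𝔓 x hxU) g).mp hx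
    -- `𝔭 ≤ 𝔮` from `η ⤳ x` (specialisation inside the affine open)
    have h𝔭𝔮 : 𝔭 ≤ 𝔓 x hxU := by
      change hU.primeIdealOf ⟨η, hηU⟩ ≤ hU.primeIdealOf ⟨x, hxU⟩
      have h1 : hU.fromSpec.base (hU.primeIdealOf ⟨η, hηU⟩) ⤳
          hU.fromSpec.base (hU.primeIdealOf ⟨x, hxU⟩) := by
        rw [IsAffineOpen.fromSpec_primeIdealOf, IsAffineOpen.fromSpec_primeIdealOf]
        exact hηx
      have h2 := (hU.fromSpec.isOpenEmbedding.isInducing.specializes_iff).mp h1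
      exact (PrimeSpectrum.le_iff_specializes _ _).mpr h2
    -- if `ord_x J ≥ m + 1` then `t f ∈ 𝔮^{m+1}` for some `t ∉ 𝔮`: excluded by `hg`
    by_contra hlt
    have hle : ((m + 1 : ℕ) : ℕ∞) ≤ idealOrder J x := by
      rw [not_le] at hlt
      exact Order.add_one_le_of_lt (by exact_mod_cast hlt)
    rw [hord x hxU] at hle
    obtain ⟨t, ht, htf⟩ := hle f hf𝔍
    exact hg (𝔓 x hxU) h𝔭𝔮 hgx t ht htf

/-- **The order of an ideal sheaf is generically `≤ ord_η` along the closure of `η`**: on an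
integral locally Noetherian regular excellent scheme, if `ord_η(J) = m` then there is an open
`U ∋ η` with `ord_x(J) ≤ m` for all `x ∈ U` with `η ⤳ x`.
[cite: CossartPiltant2008, Prop. 4.2 (proof)] -/
theorem exists_opens_forall_idealOrder_le {X : Scheme.{u}} [IsIntegral X] [IsLocallyNoetherian X]
    (hX : Scheme.IsRegular X) (hE : Scheme.IsExcellent X) (J : X.IdealSheafData) (η : X) {m : ℕ}
    (hm : idealOrder J η = m) :
    ∃ U : X.Opens, η ∈ U ∧ ∀ x ∈ U, η ⤳ x → idealOrder J x ≤ m :=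
  exists_opens_forall_idealOrder_le_of_isJ2 hX (fun U => ((hE U).isQuasiExcellentRing).isJ2Ring)
    J η hm

end Literature.AlgebraicGeometry.Resolution

end
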